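import Summits.FinalStateConjecture.FinalStateConjecture.Theorems.ZeroEnergyKerrOrBombStationaryLimitReductionKerrIsometryRigidityWave3Facts
import Summits.FinalStateConjecture.FinalStateConjecture.Theorems.ZeroEnergyKerrOrBombStationaryLimitReductionKerrIsometryRigidityWave3EndMatching
import Summits.FinalStateConjecture.FinalStateConjecture.Theorems.ZeroEnergyKerrOrBombStationaryLimitReductionTimeEquivariantMaps
import Literature.Geometry.Lorentzian.KerrSchildDecayFine
import Literature.Geometry.Lorentzian.KerrSchildDerivativeDecay
import Literature.Geometry.Lorentzian.KerrScriLeafGap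
import Literature.Geometry.Lorentzian.KerrStarCoord
import Literature.Geometry.Lorentzian.KerrWaveEnergy
import Literature.Geometry.Lorentzian.KerrSchildEnergyEstimate
import HarnessLib

/-!
# Route ZeroEnergyKerrOrBomb · crux `FinalStateFromKerrOrBomb` (stmt-FinalStateConjecture-17839), line `SketchIdeator1` —
# stub `stub_kerrAsymptoticRigidity` (F4 of stub 1R), layer 9b: the TILT `(Θ u)⁰ − u⁰` is bounded far out

Helper file (`--supports stmt-FinalStateConjecture-17839`; registered helper `kerrAsymptoticRigidity_tilt_bounded`).
Hypotheses: the binder list of `KerrAsymptoticRigidity` VERBATIM, then `c = 1` (layer 1) and the conclusion of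
layer 9a (`|(dΘ_x (0, v))⁰| ≤ C₉ /(r √r)` far out for spatial `v`, `‖v‖ ≤ 1`). Conclusion: the tilt
`f u = (Θ u)⁰ − u⁰` is bounded on a far region `{r ≥ R}` of the Kerr exterior.

Proof (elementary): `f` is invariant under the Kerr–Schild time translation (`T`-equivariance with `c = 1`), so
it suffices to bound `f (0, y)`; along the radial segment `s ↦ (0, s ŷ)`, `ŷ = y/‖y‖`, `s ∈ [s₀, ‖y‖]`, the
derivative of `f` is `(dΘ (0, ŷ))⁰ = O((s − |a|)^{-3/2})` (layer 9a and `r ≥ ‖x_{space}‖ − |a|`), which is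
integrable: the fencing theorem `image_norm_le_of_norm_deriv_right_le_deriv_boundary'` with the boundary
function `B s = B₀ + 2|C₉| ((s₀ − |a|)^{-1/2} − (s − |a|)^{-1/2})` gives `|f (0, y)| ≤ B₀ + 2|C₉| (s₀ − |a|)^{-1/2}`,
where `B₀` bounds the continuous `f` on the compact sphere `{u⁰ = 0, ‖u_{space}‖ = s₀}` of the open exterior.
Nothing restated; no named fact. References: Chruściel–Costa arXiv:0806.0016, §2.1; Bartnik, CPAM 39 (1986), §3.
-/

set_option linter.dupNamespace false

noncomputable section

open scoped Manifold ContDiff Topology RealInnerProductSpace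
open Set Filter Function Bornology

namespace Summit.FinalStateConjecture.FinalStateConjecture.Theorems.SymplecticDualOfTheBomb

open Literature.Geometry.Lorentzian Summit.FinalStateConjecture.FinalStateConjecture.Theorems.OneLockedExplosion

/-- `‖x_{space}‖ − |a| ≤ r(x)` when `‖x_{space}‖ ≥ |a|` (from `‖x_{space}‖² − a² ≤ r²`). [folklore] -/
private theorem spatialNorm_sub_abs_le_radius_w3 (a : ℝ) {x : E4} (hx : |a| ≤ E4.spatialNorm x) :
    E4.spatialNorm x - |a| ≤ Kerr.radius a x := by
  have h := Kerr.spatialNorm_sq_sub_sq_le_radius_sq a x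
  have h0 : 0 ≤ E4.spatialNorm x - |a| := sub_nonneg.2 hx
  have hsq : (E4.spatialNorm x - |a|) ^ 2 ≤ Kerr.radius a x ^ 2 := by
    nlinarith [abs_nonneg a, sq_abs a]
  exact (pow_le_pow_iff_left₀ h0 (Kerr.radius_nonneg a x) two_ne_zero).1 hsq

/-- The coordinate sphere `{u⁰ = 0, ‖u_{space}‖ = s₀}` of `E4` is compact. [folklore] -/
private theorem isCompact_sliceSphere_w3 (s₀ : ℝ) :
    IsCompact {u : E4 | u 0 = 0 ∧ E4.spatialNorm u = s₀} := by
  have hc0 : Continuous fun u : E4 ↦ u 0 := PiLp.continuous_apply 2 _ 0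
  have hcn : Continuous fun u : E4 ↦ E4.spatialNorm u := continuous_norm.comp E4.spatial.continuous
  have hclosed : IsClosed {u : E4 | u 0 = 0 ∧ E4.spatialNorm u = s₀} :=
    (isClosed_eq hc0 continuous_const).inter (isClosed_eq hcn continuous_const)
  refine Metric.isCompact_of_isClosed_isBounded hclosed ?_
  refine (Metric.isBounded_closedBall (x := (0 : E4)) (r := |s₀|)).subset fun u hu ↦ ?_
  obtain ⟨hu0, hus⟩ := hu
  rw [Metric.mem_closedBall, dist_zero_right]
  have h4 := E4.norm_sq_eq_time_sq_add u
  rw [hu0, hus] at h4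
  have h5 : ‖u‖ ^ 2 ≤ |s₀| ^ 2 := by rw [sq_abs]; nlinarith
  exact (pow_le_pow_iff_left₀ (norm_nonneg u) (abs_nonneg _) two_ne_zero).1 h5

/-- `d/ds (s − |a|)^{-1/2} = −1 / (2 (s − |a|) √(s − |a|))` for `s > |a|`. [folklore] -/
private theorem hasDerivAt_inv_sqrt_sub_w3 {a s : ℝ} (hs : |a| < s) :
    HasDerivAt (fun x : ℝ ↦ (Real.sqrt (x - |a|))⁻¹) (-(1 / (2 * ((s - |a|) * Real.sqrt (s - |a|))))) s := by
  have ht : 0 < s - |a| := sub_pos.2 hs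
  have hsq : 0 < Real.sqrt (s - |a|) := Real.sqrt_pos.2 ht
  have h1 : HasDerivAt (fun x : ℝ ↦ Real.sqrt (x - |a|)) (1 / (2 * Real.sqrt (s - |a|))) s := by
    simpa using ((hasDerivAt_id s).sub_const |a|).sqrt (by simpa using ht.ne')
  refine (h1.fun_inv hsq.ne').congr_deriv ?_
  rw [Real.sq_sqrt ht.le]
  generalize s - |a| = t at hsq ⊢
  generalize Real.sqrt t = w at hsq ⊢
  ring

/-- **Registered helper `kerrAsymptoticRigidity_tilt_bounded`** (layer 9b of F4 = `KerrAsymptoticRigidity`; its binder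
list verbatim, then `c = 1` and the tilt-derivative bound of layer 9a): the tilt `(Θ u)⁰ − c u⁰` is bounded on a far
region `{r ≥ R}` of the Kerr exterior. `T`-invariance of the tilt reduces to the slice `{u⁰ = 0}`; there one
integrates the `O((s − |a|)^{-3/2})` radial derivative from the compact sphere `{‖u_{space}‖ = s₀}` (fencing theorem
with boundary function `B₀ + 2|C₉|((s₀ − |a|)^{-1/2} − (s − |a|)^{-1/2})`). Chruściel–Costa arXiv:0806.0016, §2.1;
Bartnik 1986, §3. [folklore] -/
theorem kerrAsymptoticRigidity_tilt_bounded : ∀ (𝓑 : StationaryAFBlackHole.{0}) (A : 𝓑.AdaptedChart) (M a c : ℝ) (Θ : E4 → E4), ChartIsAsymptoticallyCartesian A → ChartIsAsymptoticallySchwarzschildean' A → Kerr.IsSubextremal M a → 0 < c → ContDiffOn ℝ ∞ Θ (Kerr.exterior M a : Set E4) → Set.InjOn Θ (Kerr.exterior M a : Set E4) → Set.MapsTo Θ (Kerr.exterior M a : Set E4) (A.domain : Set E4) → (∀ x ∈ (Kerr.exterior M a : Set E4), ∀ s : ℝ, Θ (x + s • E4.basisVector 0) = Θ x + (c * s) •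 E4.basisVector 0) → (∀ x ∈ (Kerr.exterior M a : Set E4), ∀ v w : E4, A.bilin (Θ x) (fderiv ℝ Θ x v) (fderiv ℝ Θ x w) = Kerr.bilin M a x v w) → Θ '' (Kerr.exterior M a : Set E4) = {u : E4 | ∃ h : u ∈ A.domain, A.toFun ⟨u, h⟩ ∈ 𝓑.doc} → (∀ R₁ : ℝ, ∃ R : ℝ, ∀ x ∈ (Kerr.exterior M a : Set E4), R ≤ Kerr.radius a x → R₁ ≤ A.radius (Θ x)) → c = 1 → (∃ R₉ C₉ : ℝ, ∀ x ∈ (Kerr.exterior M a : Set E4), R₉ ≤ Kerr.radius a x → ∀ v : E3, ‖v‖ ≤ 1 → |fderiv ℝ Θ x (E4.ofTimeSpace 0 v) 0| ≤ C₉ / (Kerr.radius a x * Real.sqrt (Kerr.radius a x))) → ∃ R L : ℝ, ∀ u ∈ (Kerr.exterior M a : Set E4), R ≤ Kerr.radius a u → |Θ u 0 - c * u 0| ≤ L := by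
  intro 𝓑 A M a c Θ _ _ hMa _ hΘs _ _ hΘT _ _ _ hc1 h9
  subst hc1
  obtain ⟨R₉, C₉, h9⟩ := h9
  set S : Set E4 := (Kerr.exterior M a : Set E4) with hS_def
  have hSo : IsOpen S := (Kerr.exterior M a).isOpen
  have hM : 0 < M := hMa.pos
  have hrp : 0 < Kerr.rPlus M a := Kerr.rPlus_pos hM a
  -- the threshold radius `s₀`
  obtain ⟨s₀, hs₀_def⟩ : ∃ s₀ : ℝ, s₀ = |R₉| + |a| + Kerr.rPlus M a + 1 := ⟨_, rfl⟩
  have hs₀1 : 1 ≤ s₀ - |a| := by rw [hs₀_def]; linarith [abs_nonneg R₉]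
  have hs₀0 : 0 < s₀ := by linarith [abs_nonneg a]
  -- points with large spatial radius lie in the far exterior
  have key : ∀ x : E4, s₀ ≤ E4.spatialNorm x →
      x ∈ S ∧ R₉ ≤ Kerr.radius a x ∧ E4.spatialNorm x - |a| ≤ Kerr.radius a x := by
    intro x hx
    have h1 : E4.spatialNorm x - |a| ≤ Kerr.radius a x :=
      spatialNorm_sub_abs_le_radius_w3 a (by linarith)
    refine ⟨?_, ?_, h1⟩
    · rw [hS_def, SetLike.mem_coe, Kerr.mem_exterior, max_lt_iff]
      constructor <;> linarith [abs_nonneg R₉]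
    · linarith [le_abs_self R₉]
  -- the tilt is continuous on the open exterior, hence bounded on the compact sphere `K`
  set K : Set E4 := {u : E4 | u 0 = 0 ∧ E4.spatialNorm u = s₀} with hK_def
  have hKS : K ⊆ S := fun u hu ↦ (key u hu.2.ge).1
  have hKc : IsCompact K := isCompact_sliceSphere_w3 s₀
  have hc0 : Continuous fun u : E4 ↦ u 0 := PiLp.continuous_apply 2 _ 0
  have hf₀ : ContinuousOn (fun u : E4 ↦ Θ u 0 - 1 * u 0) S :=
    (hc0.comp_continuousOn hΘs.continuousOn).sub (continuous_const.mul hc0).continuousOn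
  obtain ⟨B₀, hB₀⟩ := hKc.exists_bound_of_continuousOn (hf₀.mono hKS)
  refine ⟨s₀, B₀ + 2 * |C₉| * (Real.sqrt (s₀ - |a|))⁻¹, fun u hu huR ↦ ?_⟩
  -- the spatial part `y` of `u`, the unit vector `ŷ` and the spatial direction `q = (0, ŷ)`
  set y : E3 := E4.spatial u with hy_def
  have hyn : E4.spatialNorm u = ‖y‖ := rfl
  have hy₀ : s₀ ≤ ‖y‖ := huR.trans (Kerr.radius_le_spatialNorm a u)
  have hypos : 0 < ‖y‖ := hs₀0.trans_le hy₀
  obtain ⟨ŷ, hŷ_def⟩ : ∃ ŷ : E3, ŷ = ‖y‖⁻¹ • y := ⟨_, rfl⟩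
  have hŷn : ‖ŷ‖ = 1 := by rw [hŷ_def, norm_smul, norm_inv, norm_norm, inv_mul_cancel₀ hypos.ne']
  obtain ⟨q, hq_def⟩ : ∃ q : E4, q = E4.ofTimeSpace 0 ŷ := ⟨_, rfl⟩
  have hq0 : q 0 = 0 := by rw [hq_def]; exact E4.ofTimeSpace_apply_zero 0 ŷ
  have hqn : ‖E4.spatial q‖ = 1 := by rw [hq_def, E4.spatial_ofTimeSpace, hŷn]
  have hray0 : ∀ s : ℝ, (s • q) 0 = 0 := fun s ↦ by simp [hq0]
  have hrayn : ∀ s : ℝ, 0 ≤ s → E4.spatialNorm (s • q) = s := fun s hs ↦ by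
    show ‖E4.spatial (s • q)‖ = s
    rw [map_smul, norm_smul, Real.norm_of_nonneg hs, hqn, mul_one]
  have hray : ∀ s : ℝ, s₀ ≤ s →
      s • q ∈ S ∧ R₉ ≤ Kerr.radius a (s • q) ∧ s - |a| ≤ Kerr.radius a (s • q) := by
    intro s hs
    have h := key (s • q) (by rw [hrayn s (hs₀0.le.trans hs)]; exact hs)
    rwa [hrayn s (hs₀0.le.trans hs)] at h
  -- the tilt along the ray `s ↦ s q` and its derivative
  have hgd : ∀ s : ℝ, s₀ ≤ s →
      HasDerivAt (fun t : ℝ ↦ Θ (t • q) 0) (fderiv ℝ Θ (s • q) q 0) s := by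
    intro s hs
    have hxS := (hray s hs).1
    have hdiff : DifferentiableAt ℝ Θ (s • q) :=
      (hΘs.differentiableOn (by simp)).differentiableAt (hSo.mem_nhds hxS)
    have hγ : HasDerivAt (fun t : ℝ ↦ t • q) q s := by
      simpa using (hasDerivAt_id s).smul_const q
    have h1 : HasDerivAt (fun t : ℝ ↦ Θ (t • q)) (fderiv ℝ Θ (s • q) q) s :=
      hdiff.hasFDerivAt.comp_hasDerivAt s hγ
    have h2 := (PiLp.hasFDerivAt_apply (𝕜 := ℝ) 2 (Θ (s • q)) (0 : Fin 4)).comp_hasDerivAt s h1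
    simpa [Function.comp_def] using h2
  -- the derivative bound of layer 9a along the ray
  have hbound : ∀ s : ℝ, s₀ ≤ s →
      |fderiv ℝ Θ (s • q) q 0| ≤ |C₉| / ((s - |a|) * Real.sqrt (s - |a|)) := by
    intro s hs
    obtain ⟨hxS, hR9, hr⟩ := hray s hs
    have ht : 0 < s - |a| := by linarith
    have hr0 : 0 < Kerr.radius a (s • q) := ht.trans_le hr
    have h := h9 (s • q) hxS hR9 ŷ hŷn.le
    rw [← hq_def] at h
    calc |fderiv ℝ Θ (s • q) q 0|
        ≤ C₉ / (Kerr.radius a (s • q) * Real.sqrt (Kerr.radius a (s • q))) := h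
      _ ≤ |C₉| / (Kerr.radius a (s • q) * Real.sqrt (Kerr.radius a (s • q))) := by
          gcongr; exact le_abs_self _
      _ ≤ |C₉| / ((s - |a|) * Real.sqrt (s - |a|)) :=
          div_le_div_of_nonneg_left (abs_nonneg _) (by positivity)
            (mul_le_mul hr (Real.sqrt_le_sqrt hr) (Real.sqrt_nonneg _) hr0.le)
  -- the boundary function and its derivative
  have hBd : ∀ s : ℝ, s₀ ≤ s →
      HasDerivAt (fun x : ℝ ↦ B₀ + 2 * |C₉| * ((Real.sqrt (s₀ - |a|))⁻¹ - (Real.sqrt (x - |a|))⁻¹))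
        (|C₉| / ((s - |a|) * Real.sqrt (s - |a|))) s := by
    intro s hs
    have ht : 0 < s - |a| := by linarith
    have hsq : 0 < Real.sqrt (s - |a|) := Real.sqrt_pos.2 ht
    have h2 := hasDerivAt_inv_sqrt_sub_w3 (a := a) (s := s) (by linarith)
    refine (((h2.const_sub (Real.sqrt (s₀ - |a|))⁻¹).const_mul (2 * |C₉|)).const_add B₀).congr_deriv ?_
    generalize s - |a| = t
    generalize Real.sqrt t = w
    ring
  -- fencing on `[s₀, ‖y‖]`
  have hcont : ContinuousOn (fun t : ℝ ↦ Θ (t • q) 0) (Icc s₀ ‖y‖) := fun s hs ↦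
    (hgd s hs.1).continuousAt.continuousWithinAt
  have hBc : ContinuousOn
      (fun x : ℝ ↦ B₀ + 2 * |C₉| * ((Real.sqrt (s₀ - |a|))⁻¹ - (Real.sqrt (x - |a|))⁻¹)) (Icc s₀ ‖y‖) :=
    fun s hs ↦ (hBd s hs.1).continuousAt.continuousWithinAt
  have hga : ‖Θ (s₀ • q) 0‖ ≤ B₀ + 2 * |C₉| * ((Real.sqrt (s₀ - |a|))⁻¹ - (Real.sqrt (s₀ - |a|))⁻¹) := by
    have hK : s₀ • q ∈ K := ⟨hray0 s₀, hrayn s₀ hs₀0.le⟩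
    have h := hB₀ (s₀ • q) hK
    simp only [hray0, mul_zero, sub_zero] at h
    rw [sub_self, mul_zero, add_zero]
    exact h
  have hfence := image_norm_le_of_norm_deriv_right_le_deriv_boundary' hcont
    (fun s hs ↦ (hgd s hs.1).hasDerivWithinAt) hga hBc (fun s hs ↦ (hBd s hs.1).hasDerivWithinAt)
    (fun s hs ↦ by rw [Real.norm_eq_abs]; exact hbound s hs.1)
  have hend : |Θ (‖y‖ • q) 0| ≤ B₀ + 2 * |C₉| * ((Real.sqrt (s₀ - |a|))⁻¹ - (Real.sqrt (‖y‖ - |a|))⁻¹) := by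
    simpa only [Real.norm_eq_abs] using hfence (right_mem_Icc.2 hy₀)
  -- back to `u`: `u = (0, y) + u⁰ e₀`, `‖y‖ q = (0, y)`, and the tilt is `T`-invariant
  have hyq : ‖y‖ • q = E4.ofTimeSpace 0 y := by
    rw [hq_def, ← E4.ofTimeSpace_smul, mul_zero, hŷ_def, smul_smul, mul_inv_cancel₀ hypos.ne', one_smul]
  have hu'S : E4.ofTimeSpace 0 y ∈ S := by rw [← hyq]; exact (hray ‖y‖ hy₀).1
  have huu' : u = E4.ofTimeSpace 0 y + (u 0) • E4.basisVector 0 :=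
    (ofTimeSpace_zero_spatial_add_time_smul u).symm
  have hΘu : Θ u 0 - 1 * u 0 = Θ (E4.ofTimeSpace 0 y) 0 := by
    have h := hΘT (E4.ofTimeSpace 0 y) hu'S (u 0)
    rw [← huu'] at h
    rw [h]
    simp
  rw [hΘu, ← hyq]
  have hinv : 0 ≤ (Real.sqrt (‖y‖ - |a|))⁻¹ := inv_nonneg.2 (Real.sqrt_nonneg _)
  nlinarith [abs_nonneg C₉]

end Summit.FinalStateConjecture.FinalStateConjecture.Theorems.SymplecticDualOfTheBomb

end
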